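import Literature.AlgebraicGeometry.Resolution.AlterationsNormalFormStrictTransform
import Literature.AlgebraicGeometry.Resolution.AlterationsProofs
import Literature.AlgebraicGeometry.Resolution.ComponentGluing
import Mathlib.AlgebraicGeometry.Morphisms.ClosedImmersion
import Mathlib.AlgebraicGeometry.PullbackCarrier
import Mathlib.RingTheory.LocalRing.ResidueField.Basic
import HarnessLib

/-!
# `EquisingularLift`, line `Sketch` — transport of strict transforms to the special fibre (helper T2)

Crux `stmt-ResolutionOfSingularities-15660` = `Theses.EquisingularLift.EquisingularLift`; helper T2 of `L/w45b/CRUX-PLAN.md` §3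
(architecture of the `n = 3` stub S10): EL encodes a chain of blow-ups `τ : X'' → X'` of the `O`-ambient with the strict transform
of the closed SET `Y' ⊆ X'_s` (inside the special fibre) carried as the closed set `closure τ⁻¹(Y' ∖ V(C))` with its REDUCED closed
subscheme structure. This file shows that both the set and the reduced scheme can be computed INSIDE THE SPECIAL FIBRE:

Let `j' : Z' → X'` be a closed immersion (the special fibre `X'_κ = X' ×_{Spec O} Spec κ → X'`), `Y' ⊆ j'(Z')`, `S ⊆ X'` any set
(the centre), and `X'' ×_{X'} Z'` the base change with projections `f : X'' ×_{X'} Z' → X''` (a closed immersion) and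
`τ' : X'' ×_{X'} Z' → Z'` (for an `O`-flat exceptional divisor, `τ'` IS the blow-up of the special fibre along `C·𝒪_{X'_κ}`:
`IsBlowup.pullback_snd_of_flat_exceptional`, Stacks 0805 — not needed here). Then

* `preimage_diff_eq_image_pullback`, `closure_preimage_diff_eq_image_pullback` — `closure τ⁻¹(Y' ∖ S)` is the image under `f` of
  `closure τ'⁻¹(j'⁻¹Y' ∖ j'⁻¹S)`, the strict-transform set computed in `Z'` (topology of the cartesian square + `f` a closed
  embedding);
* `exists_iso_subscheme_vanishingIdeal_image` — for a closed immersion `j : Z → X` and a closed `T ⊆ Z`, the reduced closed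
  subscheme of `X` on `j(T)` is isomorphic over `j` to the reduced closed subscheme of `Z` on `T` (a closed immersion from a
  reduced scheme is the reduced structure on its image: `ker_eq_vanishingIdeal_range`, `IsClosedImmersion.isIso_lift`);
  `isRegular_subscheme_vanishingIdeal_image_iff` — hence one is regular iff the other is;
* `closure_preimage_diff_eq_image_specialFibre`, `isRegular_reducedStrictTransform_iff_specialFibre` — the two statements for the
  special fibre over a local ring `O` (`j' = pullback.fst r' (Spec κ → Spec O)`, `Y' ⊆ r'⁻¹(s)`, `S = V(C)`,
  `j'⁻¹ V(C) = V(C·𝒪_{X'_κ})`): EL's final clause «`V(closure S')_red` is regular» may be checked on the special-fibre tower.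

References: U. Görtz, T. Wedhorn, *Algebraic Geometry I*, 2nd ed. 2020, Prop. 13.91/13.96 (strict transforms); The Stacks Project,
Tags 0805, 01J3 (reduced induced structure).
-/

set_option linter.dupNamespace false -- mandated namespace `Summit.<Summit>.<Problem>` of this single-conjunct summit

noncomputable section

namespace Summit.ResolutionOfSingularities.ResolutionOfSingularities.Cruxes.EquisingularLift.StrataSplit

open CategoryTheory CategoryTheory.Limits AlgebraicGeometry TopologicalSpace Topology
open Literature.AlgebraicGeometry.Resolution Scheme.IdealSheafData

universe u

/-! ## The strict-transform set is computed inside any closed subscheme containing `Y'` -/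

/-- **Strict transforms through a cartesian square.** For `τ : X'' → X'`, `j' : Z' → X'`, `Y' ⊆ j'(Z')` and any `S ⊆ X'`:
`τ⁻¹(Y' ∖ S) = f(τ'⁻¹(j'⁻¹Y' ∖ j'⁻¹S))`, where `f, τ'` are the projections of `X'' ×_{X'} Z'` (points of a fibre product of
schemes surject onto pairs with the same image). [folklore] -/
theorem preimage_diff_eq_image_pullback {X' X'' Z' : Scheme.{u}} (τ : X'' ⟶ X') (j' : Z' ⟶ X') (Y' S : Set X')
    (hY : Y' ⊆ Set.range j') :
    τ ⁻¹' (Y' \ S) = (pullback.fst τ j') '' ((pullback.snd τ j') ⁻¹' (j' ⁻¹' Y' \ j' ⁻¹' S)) := by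
  ext x
  constructor
  · rintro ⟨hxY, hxS⟩
    obtain ⟨y, hy⟩ := hY hxY
    obtain ⟨z, hz₁, hz₂⟩ := Scheme.Pullback.exists_preimage_pullback (f := τ) (g := j') x y hy.symm
    refine ⟨z, ?_, hz₁⟩
    simp only [Set.mem_preimage, Set.mem_sdiff, hz₂, hy]
    exact ⟨hxY, hxS⟩
  · rintro ⟨z, ⟨hzY, hzS⟩, rfl⟩
    simp only [Set.mem_preimage, Set.mem_sdiff] at hzY hzS ⊢
    rw [← Scheme.Hom.comp_apply, pullback.condition, Scheme.Hom.comp_apply]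
    exact ⟨hzY, hzS⟩

/-- **The strict-transform set is computed inside the closed subscheme**: with `j'` a closed immersion (so that the projection
`X'' ×_{X'} Z' → X''` is a closed embedding), `closure τ⁻¹(Y' ∖ S)` is the image of `closure τ'⁻¹(j'⁻¹Y' ∖ j'⁻¹S)`.
[folklore] -/
theorem closure_preimage_diff_eq_image_pullback {X' X'' Z' : Scheme.{u}} (τ : X'' ⟶ X') (j' : Z' ⟶ X')
    [IsClosedImmersion j'] (Y' S : Set X') (hY : Y' ⊆ Set.range j') :
    closure (τ ⁻¹' (Y' \ S)) =
      (pullback.fst τ j') '' closure ((pullback.snd τ j') ⁻¹' (j' ⁻¹' Y' \ j' ⁻¹' S)) := by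
  rw [preimage_diff_eq_image_pullback τ j' Y' S hY,
    (pullback.fst τ j').isClosedEmbedding.closure_image_eq]

/-! ## The reduced structure on a closed subset of a closed subscheme -/

/-- **The reduced closed subscheme on `j(T)` is the reduced closed subscheme on `T`**, for a closed immersion `j : Z → X` and a
closed `T ⊆ Z`: there is an isomorphism `V_Z(T)_red ≅ V_X(j(T))_red` over `j` (the composite `V_Z(T)_red → Z → X` is a closed
immersion from a reduced scheme with image `j(T)`, hence has kernel the vanishing ideal sheaf of `j(T)`).
[cite: StacksProject, Tag 01J3] -/
theorem exists_iso_subscheme_vanishingIdeal_image {X Z : Scheme.{u}} (j : Z ⟶ X) [IsClosedImmersion j] (T : Closeds Z)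
    (hT : IsClosed (j '' (T : Set Z))) :
    ∃ e : (vanishingIdeal T).subscheme ≅ (vanishingIdeal (⟨j '' (T : Set Z), hT⟩ : Closeds X)).subscheme,
      e.hom ≫ (vanishingIdeal (⟨j '' (T : Set Z), hT⟩ : Closeds X)).subschemeι = (vanishingIdeal T).subschemeι ≫ j := by
  haveI : IsReduced (vanishingIdeal T).subscheme := ComponentGluing.isReduced_subscheme_vanishingIdeal T
  -- the closed immersion `V_Z(T)_red → Z → X` and its image
  let g : (vanishingIdeal T).subscheme ⟶ X := (vanishingIdeal T).subschemeι ≫ j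
  have hrange : Set.range g = j '' (T : Set Z) := by
    simp only [g, Scheme.Hom.comp_base, TopCat.coe_comp, Set.range_comp]
    rw [range_subschemeι, coe_support_vanishingIdeal]
  -- same kernel as the reduced closed subscheme of `X` on `j(T)`
  have hker : (vanishingIdeal (⟨j '' (T : Set Z), hT⟩ : Closeds X)).subschemeι.ker = g.ker := by
    rw [ker_subschemeι, ker_eq_vanishingIdeal_range g (hrange ▸ hT : IsClosed (Set.range g))]
    congr 1
    exact Closeds.ext hrange.symm
  -- adapted from `exists_isBlowup_reducedStrictTransform` (same line)
  let e : (vanishingIdeal T).subscheme ⟶ (vanishingIdeal (⟨j '' (T : Set Z), hT⟩ : Closeds X)).subscheme :=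
    IsClosedImmersion.lift _ g hker.le
  haveI : IsIso e := IsClosedImmersion.isIso_lift _ g hker
  exact ⟨asIso e, IsClosedImmersion.lift_fac _ g hker.le⟩

/-- **Regularity of the reduced structure on `j(T)` is regularity of the reduced structure on `T`** (`j` a closed immersion).
[folklore] -/
theorem isRegular_subscheme_vanishingIdeal_image_iff {X Z : Scheme.{u}} (j : Z ⟶ X) [IsClosedImmersion j] (T : Closeds Z)
    (hT : IsClosed (j '' (T : Set Z))) :
    Scheme.IsRegular (vanishingIdeal (⟨j '' (T : Set Z), hT⟩ : Closeds X)).subscheme ↔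
      Scheme.IsRegular (vanishingIdeal T).subscheme := by
  obtain ⟨e, -⟩ := exists_iso_subscheme_vanishingIdeal_image j T hT
  exact ⟨fun h => Scheme.IsRegular.of_isOpenImmersion e.hom h, fun h => Scheme.IsRegular.of_isOpenImmersion e.inv h⟩

/-! ## The two statements for the special fibre over a local ring -/

/-- **EL's strict-transform set is the image of the special-fibre strict-transform set.** `O` a local ring with residue field
`κ`, `r' : X' → Spec O`, `τ : X'' → X'`, `C` an ideal sheaf on `X'` (the centre) and `Y' ⊆ r'⁻¹(s)` a subset of the special
fibre. With `j' : X'_κ = X' ×_{Spec O} Spec κ → X'` and the projections `f : X'' ×_{X'} X'_κ → X''`, `τ' : X'' ×_{X'} X'_κ → X'_κ`: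
`closure τ⁻¹(Y' ∖ V(C)) = f(closure τ'⁻¹(j'⁻¹Y' ∖ V(C·𝒪_{X'_κ})))`. (When the exceptional divisor of a blow-up `τ` along `C` is
`O`-flat, `τ'` is the blow-up of `X'_κ` along `C·𝒪_{X'_κ}` — `IsBlowup.pullback_snd_of_flat_exceptional` — and the right-hand
closure is its strict-transform set.) [folklore] -/
theorem closure_preimage_diff_eq_image_specialFibre : ∀ (O : Type) [CommRing O] [IsLocalRing O] (X' X'' : AlgebraicGeometry.Scheme.{0}) (r' : X' ⟶ AlgebraicGeometry.Spec (.of O)) (τ : X'' ⟶ X') (C : X'.IdealSheafData) (Y' : Set X'), Y' ⊆ r' ⁻¹' {IsLocalRing.closedPoint O} → closure (τ ⁻¹' (Y' \ (C.support : Set X'))) = (CategoryTheory.Limits.pullback.fst τ (CategoryTheory.Limits.pullback.fst r' (AlgebraicGeometry.Spec.map (CommRingCat.ofHom (IsLocalRing.residue O))))) '' closure ((CategoryTheory.Limits.pullback.snd τ (CategoryTheory.Limits.pullback.fst r' (AlgebraicGeometry.Spec.map (CommRingCat.ofHom (IsLocalRing.residue O))))) ⁻¹' (((CategoryTheory.Limits.pullback.fst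 r' (AlgebraicGeometry.Spec.map (CommRingCat.ofHom (IsLocalRing.residue O)))) ⁻¹' Y') \ ((C.comap (CategoryTheory.Limits.pullback.fst r' (AlgebraicGeometry.Spec.map (CommRingCat.ofHom (IsLocalRing.residue O))))).support : Set ↑(CategoryTheory.Limits.pullback r' (AlgebraicGeometry.Spec.map (CommRingCat.ofHom (IsLocalRing.residue O))))))) := by
  intro O _ _ X' X'' r' τ C Y' hY
  haveI : IsClosedImmersion (Spec.map (CommRingCat.ofHom (IsLocalRing.residue O))) :=
    IsClosedImmersion.spec_of_surjective _ IsLocalRing.residue_surjective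
  have hrange : Y' ⊆ Set.range (pullback.fst r' (Spec.map (CommRingCat.ofHom (IsLocalRing.residue O)))) := by
    rw [Scheme.Pullback.range_fst]
    intro y hy
    have hy' : r' y = IsLocalRing.closedPoint O := hY hy
    rw [Set.mem_preimage, hy']
    exact ⟨IsLocalRing.closedPoint _, IsLocalRing.PrimeSpectrum.comap_residue O _⟩
  rw [closure_preimage_diff_eq_image_pullback τ _ Y' _ hrange, support_comap]
  rfl

/-- **EL's final clause can be checked on the special fibre.** In the same setting, the reduced closed subscheme of `X''` on
`closure τ⁻¹(Y' ∖ V(C))` is regular iff the reduced closed subscheme of `X'' ×_{X'} X'_κ` on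
`closure τ'⁻¹(j'⁻¹Y' ∖ V(C·𝒪_{X'_κ}))` is. [folklore] -/
theorem isRegular_reducedStrictTransform_iff_specialFibre : ∀ (O : Type) [CommRing O] [IsLocalRing O] (X' X'' : AlgebraicGeometry.Scheme.{0}) (r' : X' ⟶ AlgebraicGeometry.Spec (.of O)) (τ : X'' ⟶ X') (C : X'.IdealSheafData) (Y' : Set X'), Y' ⊆ r' ⁻¹' {IsLocalRing.closedPoint O} → (Literature.AlgebraicGeometry.Resolution.Scheme.IsRegular (AlgebraicGeometry.Scheme.IdealSheafData.vanishingIdeal (⟨closure (τ ⁻¹' (Y' \ (C.support : Set X'))), isClosed_closure⟩ : TopologicalSpace.Closeds X'')).subscheme ↔ Literature.AlgebraicGeometry.Resolution.Scheme.IsRegular (AlgebraicGeometry.Scheme.IdealSheafData.vanishingIdeal (⟨closure ((CategoryTheory.Limits.pullback.snd τ (CategoryTheory.Limits.pullback.fst r' (AlgebraicGeometry.Spec.map (CommRingCat.ofHom (IsLocalRing.residue O))))) ⁻¹' (((CategoryTheory.Limits.pullback.fst r' (AlgebraicGeometry.Spec.map (CommRingCat.ofHom (IsLocalRing.residue O))))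 ⁻¹' Y') \ ((C.comap (CategoryTheory.Limits.pullback.fst r' (AlgebraicGeometry.Spec.map (CommRingCat.ofHom (IsLocalRing.residue O))))).support : Set ↑(CategoryTheory.Limits.pullback r' (AlgebraicGeometry.Spec.map (CommRingCat.ofHom (IsLocalRing.residue O))))))), isClosed_closure⟩ : TopologicalSpace.Closeds ↑(CategoryTheory.Limits.pullback τ (CategoryTheory.Limits.pullback.fst r' (AlgebraicGeometry.Spec.map (CommRingCat.ofHom (IsLocalRing.residue O))))))).subscheme) := by
  intro O _ _ X' X'' r' τ C Y' hY
  haveI : IsClosedImmersion (Spec.map (CommRingCat.ofHom (IsLocalRing.residue O))) :=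
    IsClosedImmersion.spec_of_surjective _ IsLocalRing.residue_surjective
  set f := pullback.fst τ (pullback.fst r' (Spec.map (CommRingCat.ofHom (IsLocalRing.residue O)))) with hf
  set T : Closeds ↑(pullback τ (pullback.fst r' (Spec.map (CommRingCat.ofHom (IsLocalRing.residue O))))) :=
    ⟨closure ((pullback.snd τ (pullback.fst r' (Spec.map (CommRingCat.ofHom (IsLocalRing.residue O))))) ⁻¹'
      (((pullback.fst r' (Spec.map (CommRingCat.ofHom (IsLocalRing.residue O)))) ⁻¹' Y') \
        ((C.comap (pullback.fst r' (Spec.map (CommRingCat.ofHom (IsLocalRing.residue O))))).support : Set _))),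
      isClosed_closure⟩ with hT
  have heq : closure (τ ⁻¹' (Y' \ (C.support : Set X'))) = f '' (T : Set _) :=
    closure_preimage_diff_eq_image_specialFibre O X' X'' r' τ C Y' hY
  have hcl : IsClosed (f '' (T : Set _)) := heq ▸ isClosed_closure
  have hC : (⟨closure (τ ⁻¹' (Y' \ (C.support : Set X'))), isClosed_closure⟩ : Closeds X'') = ⟨f '' (T : Set _), hcl⟩ :=
    Closeds.ext heq
  rw [hC]
  exact isRegular_subscheme_vanishingIdeal_image_iff f T hcl

end Summit.ResolutionOfSingularities.ResolutionOfSingularities.Cruxes.EquisingularLift.StrataSplit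

end
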